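import Summits.Ventures.HSemireg.Mod4IdealShapeDet
import Summits.Ventures.HSemireg.Mod4PinBlockSlope

/-!
# Venture HSemireg — MOD-4 line: the `I_Z`-SHAPE h-parts at the extreme pin of an ODD `n` (`t_0 = −q_n²`, shared by `μ_0 = q_n` and
# `μ_n = −q_n`): `dim ker(M_f − t_0) = 2·[det B⁻ = 0]` — NO drop generically, drop `2` on ONE hypersurface, never `1`; the `O_Z` row always drops by `2`

HONEST FRAMING. Part of the Lean index of the computation cell `pub-hsemireg` (seat w3-mod4-1 gen 15, W3 SPECIAL FIBRES; file of
record `HOME/widen/W3/MOD4-OFFSPLIT-w3mod4.md` §13.39). `Mod4IdealShapePinZero` ∕ `Mod4IdealShapeDet` did the even-`n` extreme pin;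
this file does the ODD-`n` one. ELEMENTARY LINEAR ALGEBRA over a field ONLY: no abelian variety, no sheaf, no Ext group, no
semiregularity map; nothing here says that HC / HC_CM / HC_AV holds; no Literature fact is declared; NO definition is introduced.

SETTING: `n = k + 1` odd, `I_Z` shape (`q_m = 0` for `1 ≤ m < n`, `q_0 ≠ 0`, `q_n ≠ 0`, any tail), `q⁰ = q[0 ↦ 0]`. For odd `n` the
`O_Z` pin values `μ_0 = q_n` and `μ_n = −q_n` share the pin `t_0 = (−1)ⁿ q_n² = −q_n²`, and each of `T_f(q⁰) ∓ q_n` has exactly ONE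
zero pivot (at `b = 0`, resp. `b = n`), so the `O_Z` row drops by `2` there for every tail (`Mod4LeadingTermPins`). The two
`n × n` Hessenberg blocks `B∓ = ((T_f(q⁰) ∓ q_n)_{r, 1+s})_{r,s<n}` (rows `0…n−1`, columns `1…n`; hypothesis-bound `Matrix.of`) have
the non-zero pivots `b = 1, …, n−1` on their sub-diagonals. WHAT IS PROVED:
* **`eq_zero_of_hessenberg_mulVec_eq_zero_of_apply_last`** — general: an upper Hessenberg matrix with non-zero sub-diagonal has
  `ker ∩ {v_last = 0} = 0` (bottom-up substitution), so its kernel is at most `1`-dimensional;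
* **`det_hankelT_idealShape_add_pin_zero_odd`** — odd `n`: `det(T_f(q) + q_n) = (−1)ⁿ q_0 · det B⁺` (the triangular product of
  `Mod4IdealShapeDet` vanishes at `b = n`); with `Mod4IdealShapeDet`: `det(T_f(q) − q_n) = (−1)ⁿ q_0 · det B⁻`;
* **`ker_hankelT_idealShape_sub_pin_zero_odd_eq_bot`** ∕ **`finrank_ker_hankelT_idealShape_sub_pin_zero_odd`** — `det B⁻ ≠ 0` ⇒
  `ker(T_f(q) − q_n) = ⊥`; `det B⁻ = 0` ⇒ `dim ker(T_f(q) − q_n) = 1` (`v ↦ v_n` is injective on that kernel);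
* the same for `T_f(q) + q_n` and `B⁺` (**`…_add_pin_zero_odd_…`**);
* **`det_hankelT_add_smul_eq_det_sub_of_odd`** — odd `n`, ANY `q`, `c`: `det(T_f + c) = det(T_f − c)` ((C8) `charpoly(−T_f) = charpoly(T_f)`
  of `Mod4MiddleMatrixSquareRoot`, evaluated); hence **`det_idealShape_blocks_eq_of_odd`**: `det B⁺ = det B⁻` — the two bits COINCIDE;
* **`finrank_ker_middleM_idealShape_pin_zero_odd_of_ne ∕ _of_eq`** — `dim ker(M_f(q) + q_n²) = 0` if `det B⁻ ≠ 0`, `= 2` if `det B⁻ = 0`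
  (`Mod4MiddleKernelSplit`): never `1` — (C8)'s «a Weil `(4m+2)`-fold never drops by exactly one» for the `I_Z` row.
READING: on a Weil `(4c+2)`-fold the `I_Z` row's middle entry at the `O_Z` pin `−q_n²` is the generic `O_Z` off-pin value MINUS `2·[det B⁻ = 0]`
— ONE hypersurface in `(q_n, …, q_{2n})` (affine in `q_{2n}` with non-zero slope by `Mod4PinBlockSlope`'s corner lemma, not restated here) —
whereas the `O_Z` row drops by `2` there for EVERY tail: for a generic tail the `I_Z` row does NOT drop at all (`n = 3`: `112` against the
`O_Z` row's `110`; on the hypersurface `110`). Everything PROVED, 0 sorry. Namespace `Summit.Ventures.HSemireg.Mod4`. References: [BourbakiAlgebre1a3] Ch. III §8;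
[BuchweitzFlenner2008HH] Prop. 6.4.4 (why these matrices).
-/

namespace Summit.Ventures.HSemireg.Mod4

open Finset Matrix

variable {K : Type*} [Field K]

/-- **upper Hessenberg with non-zero sub-diagonal: `Bv = 0`, `v_last = 0` ⇒ `v = 0`** (row `s+1` determines `v_s` from the later
coordinates). [cite: BourbakiAlgebre1a3, Ch. III §8] -/
theorem eq_zero_of_hessenberg_mulVec_eq_zero_of_apply_last {k : ℕ} (B : Matrix (Fin (k + 1)) (Fin (k + 1)) K)
    (hB : ∀ (s : Fin k) (t : Fin (k + 1)), (t : ℕ) < (s : ℕ) → B s.succ t = 0)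
    (hsub : ∀ s : Fin k, B s.succ (Fin.castSucc s) ≠ 0) {v : Fin (k + 1) → K} (hv : B *ᵥ v = 0)
    (hlast : v (Fin.last k) = 0) : v = 0 := by
  have hrow : ∀ r : Fin (k + 1), ∑ t : Fin (k + 1), B r t * v t = 0 := by
    intro r
    have h := congr_fun hv r
    simp only [Matrix.mulVec, dotProduct, Pi.zero_apply] at h
    exact h
  -- `v (k - j) = 0` by strong induction on `j`
  have key : ∀ j, j ≤ k → v ⟨k - j, by omega⟩ = 0 := by
    intro j
    refine Nat.strong_induction_on j ?_
    intro j ih hj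
    rcases Nat.eq_zero_or_pos j with rfl | hj0
    · have : (⟨k - 0, by omega⟩ : Fin (k + 1)) = Fin.last k := Fin.ext (by simp)
      rw [this]; exact hlast
    -- row `s + 1` with `s = k - j`: `B_{s+1,s} v_s + Σ_{t > s} B_{s+1,t} v_t = 0`
    set s : Fin k := ⟨k - j, by omega⟩ with hs
    have h := hrow s.succ
    rw [Finset.sum_eq_single (Fin.castSucc s)] at h
    · rcases mul_eq_zero.mp h with h1 | h1
      · exact absurd h1 (hsub s)
      · have : (⟨k - j, by omega⟩ : Fin (k + 1)) = Fin.castSucc s := Fin.ext (by simp [hs])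
        rw [this]; exact h1
    · intro t _ ht
      have htl := t.isLt
      by_cases hlt : (t : ℕ) < (s : ℕ)
      · rw [hB s t hlt, zero_mul]
      · have hgt : (s : ℕ) < (t : ℕ) := by
          have : (t : ℕ) ≠ (s : ℕ) := fun h => ht (Fin.ext (by rw [Fin.val_castSucc]; exact h))
          omega
        have h' := ih (k - (t : ℕ)) (by simp only [hs] at hgt; omega) (by omega)
        have hfin : (⟨k - (k - (t : ℕ)), by omega⟩ : Fin (k + 1)) = t := Fin.ext (by simp only; omega)
        rw [hfin] at h'
        rw [h', mul_zero]
    · intro h; exact absurd (Finset.mem_univ _) h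
  funext t
  have htl := t.isLt
  have h := key (k - (t : ℕ)) (by omega)
  have hfin : (⟨k - (k - (t : ℕ)), by omega⟩ : Fin (k + 1)) = t := Fin.ext (by simp only; omega)
  rwa [hfin] at h

/-! ### Odd `n = k + 1`: both signs at the extreme pin -/

/-- **odd `n`: `det(T_f(q) + q_n) = (−1)ⁿ q_0 · det B⁺`** for an `I_Z` shape — the triangular product of `Mod4IdealShapeDet` vanishes at
`b = n`, where the pivot is `(−1)ⁿ q_n + q_n = 0`. [cite: BourbakiAlgebre1a3, Ch. III §8] -/
theorem det_hankelT_idealShape_add_pin_zero_odd {n : ℕ} (hn : 1 ≤ n) (hodd : Odd n) {q : ℕ → K}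
    (hq : ∀ m, 1 ≤ m → m < n → q m = 0) {B : Matrix (Fin n) (Fin n) K}
    (hB : B = Matrix.of fun r s : Fin n =>
      (hankelT n (Function.update q 0 0) + q n • (1 : Matrix (Fin (n + 1)) (Fin (n + 1)) K)) (Fin.castSucc r) (Fin.succ s)) :
    (hankelT n q + q n • (1 : Matrix (Fin (n + 1)) (Fin (n + 1)) K)).det = (-1 : K) ^ n * q 0 * B.det := by
  rw [det_hankelT_idealShape_add_pin_zero hn hq hB]
  have hprod : ∏ b : Fin (n + 1), ((-1 : K) ^ (b : ℕ) * (n.choose (b : ℕ) : K) * q n + q n) = 0 := by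
    refine Finset.prod_eq_zero (Finset.mem_univ (Fin.last n)) ?_
    rw [Fin.val_last, Nat.choose_self, Nat.cast_one, mul_one, hodd.neg_one_pow]
    ring
  rw [hprod, zero_add]

/-- the `I_Z` matrix `T_f(q) ∓ c` acts on `v` as the `O_Z` matrix plus `q_0 v_0` in row `n`. -/
theorem hankelT_sub_mulVec_idealShape (n : ℕ) (q : ℕ → K) (c : K) (v : Fin (n + 1) → K) (b : Fin (n + 1)) :
    ((hankelT n q - c • (1 : Matrix (Fin (n + 1)) (Fin (n + 1)) K)) *ᵥ v) b =
      ((hankelT n (Function.update q 0 0) - c • (1 : Matrix (Fin (n + 1)) (Fin (n + 1)) K)) *ᵥ v) b +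
        if (b : ℕ) = n then q 0 * v ⟨0, by omega⟩ else 0 := by
  rw [Matrix.sub_mulVec, Matrix.sub_mulVec, Pi.sub_apply, Pi.sub_apply, hankelT_mulVec_idealShape]
  ring

/-- **rows `0 … n−1` of `(T_f(q⁰) − c) v` are `B v'`** with `v' = (v_{1+s})_s`, provided the `(0,0)` entry of `T_f(q⁰) − c` is zero
or `v_0 = 0` (`B = ((T_f(q⁰) − c)_{r,1+s})`; column `0` of a leading shape's `T_f − c` vanishes below the diagonal). -/
theorem hankelT_leading_sub_mulVec_castSucc {n : ℕ} {p : ℕ → K} (hp0 : ∀ m, m < n → p m = 0) (c : K)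
    {B : Matrix (Fin n) (Fin n) K}
    (hB : B = Matrix.of fun r s : Fin n =>
      (hankelT n p - c • (1 : Matrix (Fin (n + 1)) (Fin (n + 1)) K)) (Fin.castSucc r) (Fin.succ s))
    {v : Fin (n + 1) → K}
    (h00 : (hankelT n p - c • (1 : Matrix (Fin (n + 1)) (Fin (n + 1)) K)) 0 0 * v 0 = 0) (r : Fin n) :
    ((hankelT n p - c • (1 : Matrix (Fin (n + 1)) (Fin (n + 1)) K)) *ᵥ v) (Fin.castSucc r) =
      (B *ᵥ fun s : Fin n => v (Fin.succ s)) r := by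
  set N := hankelT n p - c • (1 : Matrix (Fin (n + 1)) (Fin (n + 1)) K) with hN
  have htri : N.BlockTriangular id := blockTriangular_hankelT_leading_sub hp0 c
  simp only [Matrix.mulVec, dotProduct]
  rw [Fin.sum_univ_succ, hB]
  simp only [Matrix.of_apply]
  have h0 : N (Fin.castSucc r) 0 * v 0 = 0 := by
    rcases Nat.eq_zero_or_pos (r : ℕ) with hr | hr
    · have : Fin.castSucc r = 0 := Fin.ext (by rw [Fin.val_castSucc, hr]; rfl)
      rw [this]; exact h00
    · have hlt : (0 : Fin (n + 1)) < Fin.castSucc r := by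
        rw [Fin.lt_def, Fin.val_zero, Fin.val_castSucc]; exact hr
      have hz : N (Fin.castSucc r) 0 = 0 := htri hlt
      rw [hz, zero_mul]
  rw [h0, zero_add]

/-- **odd `n`, `I_Z` shape, `det B⁻ ≠ 0` ⇒ `ker(T_f(q) − q_n) = ⊥`.** [cite: BourbakiAlgebre1a3, Ch. III §8] -/
theorem ker_hankelT_idealShape_sub_pin_zero_odd_eq_bot {n : ℕ} (hn : 1 ≤ n) {q : ℕ → K}
    (hq : ∀ m, 1 ≤ m → m < n → q m = 0) (hq0 : q 0 ≠ 0) {B : Matrix (Fin n) (Fin n) K}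
    (hB : B = Matrix.of fun r s : Fin n =>
      (hankelT n (Function.update q 0 0) - q n • (1 : Matrix (Fin (n + 1)) (Fin (n + 1)) K)) ⟨0 + r, by omega⟩
        ⟨0 + 1 + s, by omega⟩)
    (hdet : B.det ≠ 0) : LinearMap.ker (Matrix.toLin' (hankelT n q) - q n • LinearMap.id) = ⊥ := by
  rw [toLin'_sub_smul_id, Matrix.ker_toLin'_eq_bot_iff]
  intro v hv
  have hd : (hankelT n q - q n • (1 : Matrix (Fin (n + 1)) (Fin (n + 1)) K)).det ≠ 0 := by
    rw [det_hankelT_idealShape_sub_pin_zero hn hq hB]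
    exact mul_ne_zero (mul_ne_zero (pow_ne_zero _ (neg_ne_zero.mpr one_ne_zero)) hq0) hdet
  exact Matrix.eq_zero_of_mulVec_eq_zero hd hv

/-- **odd `n`, `I_Z` shape, `det B⁺ ≠ 0` ⇒ `ker(T_f(q) + q_n) = ⊥`.** [cite: BourbakiAlgebre1a3, Ch. III §8] -/
theorem ker_hankelT_idealShape_add_pin_zero_odd_eq_bot {n : ℕ} (hn : 1 ≤ n) (hodd : Odd n) {q : ℕ → K}
    (hq : ∀ m, 1 ≤ m → m < n → q m = 0) (hq0 : q 0 ≠ 0) {B : Matrix (Fin n) (Fin n) K}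
    (hB : B = Matrix.of fun r s : Fin n =>
      (hankelT n (Function.update q 0 0) + q n • (1 : Matrix (Fin (n + 1)) (Fin (n + 1)) K)) (Fin.castSucc r) (Fin.succ s))
    (hdet : B.det ≠ 0) : LinearMap.ker (Matrix.toLin' (hankelT n q) + q n • LinearMap.id) = ⊥ := by
  have hlin : Matrix.toLin' (hankelT n q) + q n • LinearMap.id =
      Matrix.toLin' (hankelT n q + q n • (1 : Matrix (Fin (n + 1)) (Fin (n + 1)) K)) := by
    rw [map_add, map_smul, Matrix.toLin'_one]
  rw [hlin, Matrix.ker_toLin'_eq_bot_iff]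
  intro v hv
  have hd : (hankelT n q + q n • (1 : Matrix (Fin (n + 1)) (Fin (n + 1)) K)).det ≠ 0 := by
    rw [det_hankelT_idealShape_add_pin_zero_odd hn hodd hq hB]
    exact mul_ne_zero (mul_ne_zero (pow_ne_zero _ (neg_ne_zero.mpr one_ne_zero)) hq0) hdet
  exact Matrix.eq_zero_of_mulVec_eq_zero hd hv

/-- the blocks `B∓` of an `I_Z` shape are upper Hessenberg with NON-ZERO sub-diagonal (`n = k + 1 ≥ 2`, `q_n ≠ 0`; sign `ε = ±1`,
`c = ε q_n` with `ε = 1` or `n` odd): the sub-diagonal entries are the pivots `(−1)^b C(n,b) q_n − c`, `1 ≤ b ≤ n − 1`.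
[cite: BourbakiAlgebre1a3, Ch. III §8] -/
theorem idealShape_block_subdiag_ne_zero [CharZero K] {k : ℕ} {q : ℕ → K} (hq : ∀ m, 1 ≤ m → m < k + 1 → q m = 0)
    (hqn : q (k + 1) ≠ 0) {c : K} (hc : c = q (k + 1) ∨ (c = -q (k + 1) ∧ Odd (k + 1)))
    {B : Matrix (Fin (k + 1)) (Fin (k + 1)) K}
    (hB : B = Matrix.of fun r s : Fin (k + 1) =>
      (hankelT (k + 1) (Function.update q 0 0) - c • (1 : Matrix (Fin (k + 1 + 1)) (Fin (k + 1 + 1)) K))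
        ⟨0 + r, by omega⟩ ⟨0 + 1 + s, by omega⟩) (s : Fin k) :
    B s.succ (Fin.castSucc s) ≠ 0 := by
  have hs := s.isLt
  obtain ⟨-, hqn'⟩ := idealShape_update_zero (show 1 ≤ k + 1 by omega) hq
  have hidx : (⟨0 + 1 + (Fin.castSucc s : ℕ), by simp only [Fin.val_castSucc]; omega⟩ : Fin (k + 1 + 1)) =
      ⟨0 + (s.succ : ℕ), by simp only [Fin.val_succ]; omega⟩ :=
    Fin.ext (by simp only [Fin.val_succ, Fin.val_castSucc]; omega)
  rw [hB, Matrix.of_apply, hidx, Matrix.sub_apply, Matrix.smul_apply, Matrix.one_apply_eq, smul_eq_mul, mul_one, hankelT_apply]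
  simp only [Fin.val_succ, zero_add]
  rw [show k + 1 - ((s : ℕ) + 1) + ((s : ℕ) + 1) = k + 1 by omega, hqn']
  rcases hc with hc | ⟨hc, hodd⟩
  · rw [hc]
    have h := hankelT_leading_diag_sub_ne_zero (n := k + 1) hqn (b := (s : ℕ) + 1) (c := 0) (by omega) (by omega) (by omega)
    simpa using h
  · rw [hc, sub_neg_eq_add]
    have h := hankelT_leading_diag_sub_ne_zero (n := k + 1) hqn (b := (s : ℕ) + 1) (c := k + 1) (by omega) (by omega) (by omega)
    rw [Nat.choose_self, Nat.cast_one, mul_one, hodd.neg_one_pow] at h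
    simpa [sub_neg_eq_add] using h

/-- **`v ↦ v_n` is injective on `ker(T_f(q) ∓ c)` for an `I_Z` shape** (`n = k + 1 ≥ 2`, `q_0 ≠ 0`, `q_n ≠ 0`, `c = q_n`, or `c = −q_n` with
`n` odd): rows `0…n−1` read `B∓ v' = 0` up to the term `(T_f(q⁰) ∓ c)_{00} v_0`, which vanishes (`c = q_n`: zero pivot; `c = −q_n`: row `n`
gives `q_0 v_0 = 0` first). Hence `dim ker ≤ 1`. [cite: BourbakiAlgebre1a3, Ch. III §8] -/
theorem finrank_ker_hankelT_idealShape_pin_zero_le_one [CharZero K] {k : ℕ} (hk : 1 ≤ k) {q : ℕ → K}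
    (hq : ∀ m, 1 ≤ m → m < k + 1 → q m = 0) (hq0 : q 0 ≠ 0) (hqn : q (k + 1) ≠ 0) {c : K}
    (hc : c = q (k + 1) ∨ (c = -q (k + 1) ∧ Odd (k + 1))) :
    Module.finrank K ↥(LinearMap.ker (Matrix.toLin' (hankelT (k + 1) q) - c • LinearMap.id)) ≤ 1 := by
  obtain ⟨hq0', hqn'⟩ := idealShape_update_zero (show 1 ≤ k + 1 by omega) hq
  set V := hankelT (k + 1) (Function.update q 0 0) - c • (1 : Matrix (Fin (k + 1 + 1)) (Fin (k + 1 + 1)) K) with hV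
  set B : Matrix (Fin (k + 1)) (Fin (k + 1)) K := Matrix.of fun r s : Fin (k + 1) => V ⟨0 + r, by omega⟩ ⟨0 + 1 + s, by omega⟩
    with hB
  have hB' : B = Matrix.of fun r s : Fin (k + 1) => V (Fin.castSucc r) (Fin.succ s) := by
    ext r s; rw [hB, Matrix.of_apply, Matrix.of_apply]
    congr 1 <;> exact Fin.ext (by simp only [Fin.val_succ, Fin.val_castSucc]; omega)
  have hhess := pinBlock_hessenberg (show k + 1 = 0 + (k + 1) + 0 by omega) hq0' c hB
  have hsub := idealShape_block_subdiag_ne_zero hq hqn hc hB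
  set W := LinearMap.ker (Matrix.toLin' (hankelT (k + 1) q) - c • LinearMap.id) with hW
  let f : ↥W →ₗ[K] K := (LinearMap.proj (Fin.last (k + 1))) ∘ₗ W.subtype
  have hf : Function.Injective f := by
    rw [← LinearMap.ker_eq_bot, LinearMap.ker_eq_bot']
    intro v hv
    have hvn : (v : Fin (k + 1 + 1) → K) (Fin.last (k + 1)) = 0 := by simpa [f] using hv
    have hvW : (v : Fin (k + 1 + 1) → K) ∈ LinearMap.ker (Matrix.toLin' (hankelT (k + 1) q) - c • LinearMap.id) := v.2
    rw [toLin'_sub_smul_id, LinearMap.mem_ker, Matrix.toLin'_apply] at hvW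
    -- row `b` of the `I_Z` system: `(V v)_b + [b = n] q_0 v_0 = 0`
    have hrows : ∀ b : Fin (k + 1 + 1), (V *ᵥ (v : Fin (k + 1 + 1) → K)) b +
        (if (b : ℕ) = k + 1 then q 0 * (v : Fin (k + 1 + 1) → K) ⟨0, by omega⟩ else 0) = 0 := by
      intro b
      rw [← hankelT_sub_mulVec_idealShape, hvW, Pi.zero_apply]
    -- row `n` of `V v` vanishes (everything left of the pivot is triangular-zero, and `v_n = 0`), so row `n` reads `q_0 v_0 = 0`
    have hVn : (V *ᵥ (v : Fin (k + 1 + 1) → K)) (Fin.last (k + 1)) = 0 := by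
      simp only [Matrix.mulVec, dotProduct]
      refine Finset.sum_eq_zero fun t _ => ?_
      by_cases ht : t = Fin.last (k + 1)
      · rw [ht, hvn, mul_zero]
      · have htl : (t : ℕ) < k + 1 := by
          have h1 := t.isLt
          have h2 : (t : ℕ) ≠ k + 1 := fun h => ht (Fin.ext (by rw [h, Fin.val_last]))
          omega
        have hlt : t < Fin.last (k + 1) := by rw [Fin.lt_def, Fin.val_last]; exact htl
        have hz : V (Fin.last (k + 1)) t = 0 := blockTriangular_hankelT_leading_sub hq0' c hlt
        rw [hz, zero_mul]
    have hv0 : (v : Fin (k + 1 + 1) → K) 0 = 0 := by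
      have h := hrows (Fin.last (k + 1))
      rw [hVn, zero_add, Fin.val_last, if_pos rfl] at h
      exact (mul_eq_zero.mp h).resolve_left hq0
    have h00 : V 0 0 * (v : Fin (k + 1 + 1) → K) 0 = 0 := by rw [hv0, mul_zero]
    -- hence `B v' = 0` with `v'_last = v_n = 0`, so `v' = 0`
    have hBv : B *ᵥ (fun s : Fin (k + 1) => (v : Fin (k + 1 + 1) → K) (Fin.succ s)) = 0 := by
      funext r
      rw [Pi.zero_apply, ← hankelT_leading_sub_mulVec_castSucc hq0' c hB' h00 r]
      have h := hrows (Fin.castSucc r)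
      have hr : ((Fin.castSucc r : Fin (k + 1 + 1)) : ℕ) ≠ k + 1 := by
        rw [Fin.val_castSucc]; have := r.isLt; omega
      rwa [if_neg hr, add_zero] at h
    have hv' := eq_zero_of_hessenberg_mulVec_eq_zero_of_apply_last B hhess hsub hBv
      (by show (v : Fin (k + 1 + 1) → K) (Fin.succ (Fin.last k)) = 0; rw [Fin.succ_last]; exact hvn)
    apply Subtype.ext
    funext t
    rw [ZeroMemClass.coe_zero, Pi.zero_apply]
    rcases Fin.eq_zero_or_eq_succ t with ht | ⟨s, hs⟩
    · rw [ht]; exact hv0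
    · rw [hs]; exact congr_fun hv' s
  have h := LinearMap.finrank_le_finrank_of_injective hf
  rwa [Module.finrank_self] at h

/-- **odd `n = k + 1 ≥ 3`, `I_Z` shape, `det B⁻ = 0` ⇒ `dim ker(T_f(q) − q_n) = 1`.** [cite: BourbakiAlgebre1a3, Ch. III §8] -/
theorem finrank_ker_hankelT_idealShape_sub_pin_zero_odd [CharZero K] {k : ℕ} (hk : 1 ≤ k) {q : ℕ → K}
    (hq : ∀ m, 1 ≤ m → m < k + 1 → q m = 0) (hq0 : q 0 ≠ 0) (hqn : q (k + 1) ≠ 0) {B : Matrix (Fin (k + 1)) (Fin (k + 1)) K}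
    (hB : B = Matrix.of fun r s : Fin (k + 1) =>
      (hankelT (k + 1) (Function.update q 0 0) - q (k + 1) • (1 : Matrix (Fin (k + 1 + 1)) (Fin (k + 1 + 1)) K))
        ⟨0 + r, by omega⟩ ⟨0 + 1 + s, by omega⟩)
    (hdet : B.det = 0) :
    Module.finrank K ↥(LinearMap.ker (Matrix.toLin' (hankelT (k + 1) q) - q (k + 1) • LinearMap.id)) = 1 := by
  refine le_antisymm (finrank_ker_hankelT_idealShape_pin_zero_le_one hk hq hq0 hqn (Or.inl rfl)) ?_
  have hd : (hankelT (k + 1) q - q (k + 1) • (1 : Matrix (Fin (k + 1 + 1)) (Fin (k + 1 + 1)) K)).det = 0 := by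
    rw [det_hankelT_idealShape_sub_pin_zero (show 1 ≤ k + 1 by omega) hq hB, hdet, mul_zero]
  obtain ⟨v, hv0, hv⟩ := Matrix.exists_mulVec_eq_zero_iff.mpr hd
  have hmem : v ∈ LinearMap.ker (Matrix.toLin' (hankelT (k + 1) q) - q (k + 1) • LinearMap.id) := by
    rw [toLin'_sub_smul_id, LinearMap.mem_ker, Matrix.toLin'_apply, hv]
  rw [Nat.one_le_iff_ne_zero]
  intro h0
  rw [Submodule.finrank_eq_zero] at h0
  rw [h0, Submodule.mem_bot] at hmem
  exact hv0 hmem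

/-- **odd `n = k + 1 ≥ 3`, `I_Z` shape, `det B⁺ = 0` ⇒ `dim ker(T_f(q) + q_n) = 1`.** [cite: BourbakiAlgebre1a3, Ch. III §8] -/
theorem finrank_ker_hankelT_idealShape_add_pin_zero_odd [CharZero K] {k : ℕ} (hk : 1 ≤ k) (hodd : Odd (k + 1)) {q : ℕ → K}
    (hq : ∀ m, 1 ≤ m → m < k + 1 → q m = 0) (hq0 : q 0 ≠ 0) (hqn : q (k + 1) ≠ 0) {B : Matrix (Fin (k + 1)) (Fin (k + 1)) K}
    (hB : B = Matrix.of fun r s : Fin (k + 1) =>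
      (hankelT (k + 1) (Function.update q 0 0) + q (k + 1) • (1 : Matrix (Fin (k + 1 + 1)) (Fin (k + 1 + 1)) K))
        (Fin.castSucc r) (Fin.succ s))
    (hdet : B.det = 0) :
    Module.finrank K ↥(LinearMap.ker (Matrix.toLin' (hankelT (k + 1) q) + q (k + 1) • LinearMap.id)) = 1 := by
  have hmat : hankelT (k + 1) q + q (k + 1) • (1 : Matrix (Fin (k + 1 + 1)) (Fin (k + 1 + 1)) K) =
      hankelT (k + 1) q - (-q (k + 1)) • (1 : Matrix (Fin (k + 1 + 1)) (Fin (k + 1 + 1)) K) := by rw [neg_smul, sub_neg_eq_add]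
  have hker : LinearMap.ker (Matrix.toLin' (hankelT (k + 1) q) + q (k + 1) • LinearMap.id) =
      LinearMap.ker (Matrix.toLin' (hankelT (k + 1) q) - (-q (k + 1)) • LinearMap.id) := by
    rw [toLin'_sub_smul_id, ← hmat, map_add, map_smul, Matrix.toLin'_one]
  rw [hker]
  refine le_antisymm (finrank_ker_hankelT_idealShape_pin_zero_le_one hk hq hq0 hqn (Or.inr ⟨rfl, hodd⟩)) ?_
  have hd : (hankelT (k + 1) q + q (k + 1) • (1 : Matrix (Fin (k + 1 + 1)) (Fin (k + 1 + 1)) K)).det = 0 := by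
    rw [det_hankelT_idealShape_add_pin_zero_odd (show 1 ≤ k + 1 by omega) hodd hq hB, hdet, mul_zero]
  obtain ⟨v, hv0, hv⟩ := Matrix.exists_mulVec_eq_zero_iff.mpr hd
  have hmem : v ∈ LinearMap.ker (Matrix.toLin' (hankelT (k + 1) q) - (-q (k + 1)) • LinearMap.id) := by
    rw [toLin'_sub_smul_id, LinearMap.mem_ker, Matrix.toLin'_apply, neg_smul, sub_neg_eq_add, hv]
  rw [Nat.one_le_iff_ne_zero]
  intro h0
  rw [Submodule.finrank_eq_zero] at h0
  rw [h0, Submodule.mem_bot] at hmem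
  exact hv0 hmem

/-! ### Odd `n`: `det(T_f + c) = det(T_f − c)`, so the two bits coincide -/

/-- **odd `n`: `det(T_f(q) + c) = det(T_f(q) − c)` for EVERY `q` and `c`** — (C8): the characteristic polynomials of `T_f` and `−T_f`
coincide (`Mod4MiddleMatrixSquareRoot.charpoly_neg_hankelT`), evaluated at `c`; `det(−A) = det A` in even size `n + 1`.
[cite: BourbakiAlgebre1a3, Ch. III §8] -/
theorem det_hankelT_add_smul_eq_det_sub_of_odd {n : ℕ} (hodd : Odd n) (q : ℕ → K) (c : K) :
    (hankelT n q + c • (1 : Matrix (Fin (n + 1)) (Fin (n + 1)) K)).det =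
      (hankelT n q - c • (1 : Matrix (Fin (n + 1)) (Fin (n + 1)) K)).det := by
  have h := congrArg (fun P => Polynomial.eval c P) (charpoly_neg_hankelT hodd q)
  rw [Matrix.eval_charpoly, Matrix.eval_charpoly] at h
  -- `h : det (scalar c − (−T)) = det (scalar c − T)`
  have e1 : Matrix.scalar (Fin (n + 1)) c - -hankelT n q = hankelT n q + c • (1 : Matrix (Fin (n + 1)) (Fin (n + 1)) K) := by
    rw [Matrix.scalar_apply, ← Matrix.smul_one_eq_diagonal, sub_neg_eq_add]
    exact add_comm _ _
  have e2 : Matrix.scalar (Fin (n + 1)) c - hankelT n q = -(hankelT n q - c • (1 : Matrix (Fin (n + 1)) (Fin (n + 1)) K)) := by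
    rw [Matrix.scalar_apply, ← Matrix.smul_one_eq_diagonal, neg_sub]
  have heven : Even (n + 1) := hodd.add_one
  rw [e1, e2, Matrix.det_neg, Fintype.card_fin, heven.neg_one_pow, one_mul] at h
  exact h

/-- **odd `n`, `I_Z` shape, `q_0 ≠ 0`: the two blocks have the SAME determinant, `det B⁺ = det B⁻`** — the second bit equals the first.
[cite: BourbakiAlgebre1a3, Ch. III §8] -/
theorem det_idealShape_blocks_eq_of_odd {n : ℕ} (hn : 1 ≤ n) (hodd : Odd n) {q : ℕ → K}
    (hq : ∀ m, 1 ≤ m → m < n → q m = 0) (hq0 : q 0 ≠ 0) {Bm : Matrix (Fin n) (Fin n) K}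
    (hBm : Bm = Matrix.of fun r s : Fin n =>
      (hankelT n (Function.update q 0 0) - q n • (1 : Matrix (Fin (n + 1)) (Fin (n + 1)) K)) ⟨0 + r, by omega⟩
        ⟨0 + 1 + s, by omega⟩)
    {Bp : Matrix (Fin n) (Fin n) K}
    (hBp : Bp = Matrix.of fun r s : Fin n =>
      (hankelT n (Function.update q 0 0) + q n • (1 : Matrix (Fin (n + 1)) (Fin (n + 1)) K)) (Fin.castSucc r) (Fin.succ s)) :
    Bp.det = Bm.det := by
  have h := det_hankelT_add_smul_eq_det_sub_of_odd hodd q (q n)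
  rw [det_hankelT_idealShape_add_pin_zero_odd hn hodd hq hBp, det_hankelT_idealShape_sub_pin_zero hn hq hBm] at h
  have hc : (-1 : K) ^ n * q 0 ≠ 0 := mul_ne_zero (pow_ne_zero _ (neg_ne_zero.mpr one_ne_zero)) hq0
  exact mul_left_cancel₀ hc h

/-! ### The middle entry at the odd extreme pin `t_0 = −q_n²`: `0` or `2`, never `1` -/

/-- **odd `n = k + 1 ≥ 3`, `I_Z` shape, GENERIC tail (`det B⁻ ≠ 0`) ⇒ NO DROP:** `dim ker(M_f(q) − t_0) = 0`
(`t_0 = (−1)ⁿ q_n² = −q_n²`), whereas the `O_Z` row drops by `2` there for every tail. [cite: BourbakiAlgebre1a3, Ch. III §8]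
[cite: BuchweitzFlenner2008HH, Prop. 6.4.4] -/
theorem finrank_ker_middleM_idealShape_pin_zero_odd_of_ne [CharZero K] {k : ℕ} (hk : 1 ≤ k) (hodd : Odd (k + 1))
    {q : ℕ → K} (hq : ∀ m, 1 ≤ m → m < k + 1 → q m = 0) (hq0 : q 0 ≠ 0) (hqn : q (k + 1) ≠ 0) {t : K}
    (ht : t = (-1 : K) ^ (k + 1) * (q (k + 1) * q (k + 1)))
    {Bm : Matrix (Fin (k + 1)) (Fin (k + 1)) K}
    (hBm : Bm = Matrix.of fun r s : Fin (k + 1) =>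
      (hankelT (k + 1) (Function.update q 0 0) - q (k + 1) • (1 : Matrix (Fin (k + 1 + 1)) (Fin (k + 1 + 1)) K))
        ⟨0 + r, by omega⟩ ⟨0 + 1 + s, by omega⟩)
    (hm : Bm.det ≠ 0) :
    Module.finrank K ↥(LinearMap.ker (Matrix.toLin' (middleM (k + 1) q) - t • LinearMap.id)) = 0 := by
  set Bp : Matrix (Fin (k + 1)) (Fin (k + 1)) K := Matrix.of fun r s : Fin (k + 1) =>
      (hankelT (k + 1) (Function.update q 0 0) + q (k + 1) • (1 : Matrix (Fin (k + 1 + 1)) (Fin (k + 1 + 1)) K))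
        (Fin.castSucc r) (Fin.succ s) with hBp
  have hp : Bp.det ≠ 0 := by rw [det_idealShape_blocks_eq_of_odd (by omega) hodd hq hq0 hBm hBp]; exact hm
  rw [finrank_ker_middleM_eq_add q hqn ht, ker_hankelT_idealShape_sub_pin_zero_odd_eq_bot (by omega) hq hq0 hBm hm,
    ker_hankelT_idealShape_add_pin_zero_odd_eq_bot (by omega) hodd hq hq0 hBp hp, finrank_bot]

/-- **odd `n = k + 1 ≥ 3`, `I_Z` shape, DEGENERATE tail (`det B⁻ = 0`) ⇒ DROP `2`:** `dim ker(M_f(q) − t_0) = 2` — both `±q_n` are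
eigenvalues of `T_f(q)` at once (never a drop of exactly `1`). [cite: BourbakiAlgebre1a3, Ch. III §8] [cite: BuchweitzFlenner2008HH, Prop. 6.4.4] -/
theorem finrank_ker_middleM_idealShape_pin_zero_odd_of_eq [CharZero K] {k : ℕ} (hk : 1 ≤ k) (hodd : Odd (k + 1))
    {q : ℕ → K} (hq : ∀ m, 1 ≤ m → m < k + 1 → q m = 0) (hq0 : q 0 ≠ 0) (hqn : q (k + 1) ≠ 0) {t : K}
    (ht : t = (-1 : K) ^ (k + 1) * (q (k + 1) * q (k + 1)))
    {Bm : Matrix (Fin (k + 1)) (Fin (k + 1)) K}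
    (hBm : Bm = Matrix.of fun r s : Fin (k + 1) =>
      (hankelT (k + 1) (Function.update q 0 0) - q (k + 1) • (1 : Matrix (Fin (k + 1 + 1)) (Fin (k + 1 + 1)) K))
        ⟨0 + r, by omega⟩ ⟨0 + 1 + s, by omega⟩)
    (hm : Bm.det = 0) :
    Module.finrank K ↥(LinearMap.ker (Matrix.toLin' (middleM (k + 1) q) - t • LinearMap.id)) = 2 := by
  set Bp : Matrix (Fin (k + 1)) (Fin (k + 1)) K := Matrix.of fun r s : Fin (k + 1) =>
      (hankelT (k + 1) (Function.update q 0 0) + q (k + 1) • (1 : Matrix (Fin (k + 1 + 1)) (Fin (k + 1 + 1)) K))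
        (Fin.castSucc r) (Fin.succ s) with hBp
  have hp : Bp.det = 0 := by rw [det_idealShape_blocks_eq_of_odd (by omega) hodd hq hq0 hBm hBp]; exact hm
  rw [finrank_ker_middleM_eq_add q hqn ht, finrank_ker_hankelT_idealShape_sub_pin_zero_odd hk hq hq0 hqn hBm hm,
    finrank_ker_hankelT_idealShape_add_pin_zero_odd hk hodd hq hq0 hqn hBp hp]

end Summit.Ventures.HSemireg.Mod4
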